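import Summits.Ventures.PercRepro.RankLevelSetBiIndepProfileAvoid

/-! # RankLevelSetBiIndepProfileInterval — THE «INTERVAL» FAMILIES `{B ⊆ Z ⊆ E ∖ A}`: THE LEVEL-WISE FORM FROM THE
ULC OF THE TWO-SIDED RESTRICTED PROFILE (night-1 g23, attempt 2; note proofs/NIGHT-1-BIINDEP-ULC.md §8)

For disjoint `A, B ⊆ E` the profile `D_r^{(A,B)} = #{S : #S = r, S and E ∖ S independent, B ⊆ S, S ∩ A = ∅}` is ULC
(paper §8: the `A`-variables of the `S`-side and the `B`-variables of the `T`-side set to `0` before the extraction).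
At the tight layer its ends are `D_q^{(A,B)} = #𝒜(A,B)` with `𝒜(A,B) = {Z ∈ 𝒵 : B ⊆ Z, Z ∩ A = ∅}` and
`D_p^{(A,B)} = #𝒜(B,A)` (complementation swaps the roles), and a bi-independent `t`-set `S` with `B ⊆ S`, `S ∩ A = ∅`
contains a member `Z` with `B ⊆ Z ⊆ S` (extend `E ∖ S` to an independent `p`-set inside `E ∖ B`, which holds one once
some member contains `B`). Hence, at every level `q < t < p`,
  `C(p+q,t) · min(#𝒜(A,B), #𝒜(B,A)) ≤ C(p+q,q) · #{independent t-set UP-neighbours of 𝒜(A,B)}`: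
the level-wise form holds for every interval family that is not larger than its mirror. CONDITIONAL on the named fact
`BiIndepIntervalULC M A B` (NOT proved here); `B = ∅` is `RankLevelSetBiIndepProfileAvoid`, `A = B = ∅` the global case.
Every declaration has a docstring; imports: the cell's own modules and Mathlib only. -/

namespace PercRepro

open Set Matroid Finset

variable {α : Type} (M : Matroid α) [M.Finite]

/-- **The bi-independent `r`-sets containing `B` and avoiding `A`.** -/
def biIndepInterval (A B : Set α) (r : ℕ) : Set (Set α) := {S ∈ biIndep M r | B ⊆ S ∧ Disjoint S A}

/-- They are finitely many. -/
lemma biIndepInterval_finite (A B : Set α) (r : ℕ) : (biIndepInterval M A B r).Finite :=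
  (biIndep_finite M r).subset (fun _ h => h.1)

/-- **The two-sided restricted profile** `D_r^{(A,B)}`. -/
noncomputable def biIndepIntervalCount (A B : Set α) (r : ℕ) : ℕ := (biIndepInterval M A B r).ncard

/-- **Its normalisation** `D_r^{(A,B)} / C(#E, r)`. -/
noncomputable def biIndepIntervalNorm (A B : Set α) (r : ℕ) : ℚ :=
  (biIndepIntervalCount M A B r : ℚ) / ((M.E.ncard).choose r : ℚ)

omit [M.Finite] in
/-- **THE NAMED FACT, TWO-SIDED** (a `Prop`, NOT proved here): `r ↦ D_r^{(A,B)}/C(n,r)` is log-concave with no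
internal zeros — the Lorentzian argument of the note §8. -/
def BiIndepIntervalULC (A B : Set α) : Prop :=
  (∀ r, 1 ≤ r → r + 1 ≤ M.E.ncard →
      biIndepIntervalNorm M A B (r - 1) * biIndepIntervalNorm M A B (r + 1) ≤
        biIndepIntervalNorm M A B r ^ 2) ∧
  (∀ a b c, a ≤ b → b ≤ c → 0 < biIndepIntervalCount M A B a → 0 < biIndepIntervalCount M A B c →
      0 < biIndepIntervalCount M A B b)

/-- **The interval family of members** `𝒜(A,B) = {Z ∈ 𝒵 : B ⊆ Z, Z ∩ A = ∅}`. -/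
def intervalMembers (p q : ℕ) (A B : Set α) : Set (Set α) :=
  {Z ∈ cellMembers M p q | B ⊆ Z ∧ Disjoint Z A}

/-- **The lower end**: the bi-independent `q`-sets of the interval are the interval members (tight layer). -/
lemma biIndepInterval_q_eq {p q : ℕ} (hE : M.E.ncard = p + q) (A B : Set α) :
    biIndepInterval M A B q = intervalMembers M p q A B := by
  unfold biIndepInterval intervalMembers
  rw [cellMembers_eq_biIndep M hE]

/-- **The upper end**: by complementation, the bi-independent `p`-sets of the interval `(A,B)` correspond to the
interval members of the mirror `(B,A)` (tight layer, `A, B ⊆ E`). -/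
lemma biIndepIntervalCount_p_eq {p q : ℕ} (hE : M.E.ncard = p + q) {A B : Set α} (hA : A ⊆ M.E)
    (hB : B ⊆ M.E) :
    biIndepIntervalCount M A B p = (intervalMembers M p q B A).ncard := by
  unfold biIndepIntervalCount intervalMembers
  rw [cellMembers_eq_biIndep M hE]
  refine Set.ncard_congr (fun S _ => M.E \ S) ?_ ?_ ?_
  · rintro S ⟨hS, hBS, hSA⟩
    have h1 := mem_biIndep_compl M hS
    rw [hE, show p + q - p = q by omega] at h1
    refine ⟨h1, ?_, ?_⟩
    · intro x hx
      exact ⟨hA hx, fun hxS => hSA.ne_of_mem hxS hx rfl⟩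
    · exact Set.disjoint_left.mpr (fun x hx hxB => hx.2 (hBS hxB))
  · rintro S T ⟨hS, -⟩ ⟨hT, -⟩ hST
    have h1 : M.E \ (M.E \ S) = M.E \ (M.E \ T) := by rw [hST]
    rwa [Set.sdiff_sdiff_cancel_left hS.1, Set.sdiff_sdiff_cancel_left hT.1] at h1
  · rintro Z ⟨hZ, hAZ, hZB⟩
    refine ⟨M.E \ Z, ⟨?_, ?_, ?_⟩, Set.sdiff_sdiff_cancel_left hZ.1⟩
    · have h1 := mem_biIndep_compl M hZ
      rwa [hE, show p + q - q = p by omega] at h1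
    · intro x hx
      exact ⟨hB hx, fun hxZ => hZB.ne_of_mem hxZ hx rfl⟩
    · exact Set.disjoint_left.mpr (fun x hx hxA => hx.2 (hAZ hxA))

/-- **A bi-independent `t`-set of the interval contains an interval member** (tight layer, `q < t < p`), once some
member `Z₀` of the interval exists: extend `E ∖ S` inside `E ∖ B` to an independent `p`-set `B'` (a basis of `E ∖ B`
has at least `p` elements because `E ∖ Z₀ ⊆ E ∖ B` is independent of size `p`); `Z := E ∖ B'` works. -/
lemma biIndepInterval_subset_indepLevelNbhd {p q t : ℕ} (hE : M.E.ncard = p + q) (hqt : q < t) (htp : t < p)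
    {A B : Set α} (hB : B ⊆ M.E) {Z₀ : Set α} (hZ₀ : Z₀ ∈ intervalMembers M p q A B) :
    biIndepInterval M A B t ⊆ indepLevelNbhd M p q t (intervalMembers M p q A B) := by
  rintro S ⟨⟨hSE, hcard, hind, hind'⟩, hBS, hSA⟩
  have hSfin : S.Finite := M.ground_finite.subset hSE
  -- Z₀ as a bi-independent q-set containing B
  obtain ⟨hZ₀m, hBZ₀, hZ₀A⟩ := hZ₀
  rw [cellMembers_eq_biIndep M hE] at hZ₀m
  obtain ⟨hZ₀E, hZ₀q, hZ₀ind, hZ₀ind'⟩ := hZ₀m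
  have hJ : M.E \ Z₀ ⊆ M.E \ B := Set.sdiff_subset_sdiff_right hBZ₀
  have hJp : (M.E \ Z₀).ncard = p := by
    rw [Set.ncard_sdiff' hZ₀E M.ground_finite, hZ₀q, hE]; omega
  -- E ∖ S ⊆ E ∖ B is independent; extend it to a basis J of E ∖ B
  have hIX : M.E \ S ⊆ M.E \ B := Set.sdiff_subset_sdiff_right hBS
  obtain ⟨J, hJbasis, hIJ⟩ := hind'.subset_isBasis_of_subset hIX
  have hJE : J ⊆ M.E := hJbasis.subset.trans Set.sdiff_subset
  have hJfin : J.Finite := M.ground_finite.subset hJE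
  have hJZ₀fin : (M.E \ Z₀).Finite := M.ground_finite.subset Set.sdiff_subset
  have hpJ : p ≤ J.ncard := by
    have h1 : (M.E \ Z₀).encard ≤ M.eRk (M.E \ B) := hZ₀ind'.encard_le_eRk_of_subset hJ
    rw [← hJbasis.encard_eq_eRk, ← hJZ₀fin.cast_ncard_eq, ← hJfin.cast_ncard_eq, hJp] at h1
    exact_mod_cast h1
  have hSc : (M.E \ S).ncard ≤ p := by
    rw [Set.ncard_sdiff' hSE M.ground_finite, hE, hcard]; omega
  obtain ⟨u, hSu, huJ, hu⟩ := Set.exists_subsuperset_card_eq hIJ hSc hpJ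
  have huE : u ⊆ M.E := huJ.trans hJE
  have huB : u ⊆ M.E \ B := huJ.trans hJbasis.subset
  have huind : M.Indep u := hJbasis.indep.subset huJ
  have hZS : M.E \ u ⊆ S := by
    intro x hx
    by_contra hxS
    exact hx.2 (hSu ⟨hx.1, hxS⟩)
  have hZmem : M.E \ u ∈ intervalMembers M p q A B := by
    refine ⟨?_, ?_, hSA.mono_left hZS⟩
    · rw [cellMembers_eq_biIndep M hE]
      refine ⟨Set.sdiff_subset, ?_, hind.subset hZS, ?_⟩
      · rw [Set.ncard_sdiff' huE M.ground_finite, hu, hE]; omega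
      · rw [Set.sdiff_sdiff_cancel_left huE]; exact huind
    · intro x hx
      exact ⟨hB hx, fun hxu => (huB hxu).2 hx⟩
  have hrS : M.eRk S = (t : ℕ∞) := by
    rw [hind.eRk_eq_encard, ← hSfin.cast_ncard_eq, hcard]
  refine ⟨⟨hSE, ?_, ?_, M.E \ u, hZmem, hZS⟩, hind, hcard⟩
  · rw [hrS]; exact_mod_cast hqt
  · rw [hrS]; exact_mod_cast htp

/-- **THE LEVEL-WISE FORM FOR THE INTERVAL FAMILIES** (tight layer `#E = p + q`, disjoint `A, B ⊆ E`, `q < t < p`),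
CONDITIONAL on `BiIndepIntervalULC M A B`: `C(p+q,t) · min(#𝒜(A,B), #𝒜(B,A)) ≤ C(p+q,q) · #{independent t-set
UP-neighbours of 𝒜(A,B)}`. -/
theorem levelHallUp_interval_of_biIndepIntervalULC {A B : Set α} (hULC : BiIndepIntervalULC M A B)
    (hA : A ⊆ M.E) (hB : B ⊆ M.E) {p q t : ℕ} (hE : M.E.ncard = p + q) (hqt : q < t) (htp : t < p) :
    ((p + q).choose t : ℚ) *
        (min ((intervalMembers M p q A B).ncard : ℚ) ((intervalMembers M p q B A).ncard : ℚ)) ≤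
      ((p + q).choose q : ℚ) * ((indepLevelNbhd M p q t (intervalMembers M p q A B)).ncard : ℚ) := by
  obtain ⟨hlc, hnz⟩ := hULC
  have hq_eq : biIndepIntervalCount M A B q = (intervalMembers M p q A B).ncard := by
    unfold biIndepIntervalCount; rw [biIndepInterval_q_eq M hE A B]
  have hp_eq := biIndepIntervalCount_p_eq M hE hA hB
  rw [← hq_eq, ← hp_eq]
  by_cases hq0 : biIndepIntervalCount M A B q = 0
  · rw [hq0, Nat.cast_zero, min_eq_left (by positivity), mul_zero]; positivity
  by_cases hp0 : biIndepIntervalCount M A B p = 0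
  · rw [hp0, Nat.cast_zero, min_eq_right (by positivity), mul_zero]; positivity
  have hqpos : 0 < biIndepIntervalCount M A B q := Nat.pos_of_ne_zero hq0
  have hppos : 0 < biIndepIntervalCount M A B p := Nat.pos_of_ne_zero hp0
  obtain ⟨Z₀, hZ₀⟩ : (biIndepInterval M A B q).Nonempty :=
    (Set.ncard_pos (biIndepInterval_finite M A B q)).mp hqpos
  rw [biIndepInterval_q_eq M hE A B] at hZ₀
  have hpos : ∀ r, q ≤ r → r ≤ p → 0 < biIndepIntervalNorm M A B r := by
    intro r hqr hrp
    unfold biIndepIntervalNorm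
    have hD : 0 < biIndepIntervalCount M A B r := hnz q r p hqr hrp hqpos hppos
    have hC : 0 < ((M.E.ncard).choose r : ℚ) := by
      exact_mod_cast Nat.choose_pos (by omega)
    exact div_pos (by exact_mod_cast hD) hC
  have hlc' : ∀ r, q + 1 ≤ r → r + 1 ≤ p →
      biIndepIntervalNorm M A B (r - 1) * biIndepIntervalNorm M A B (r + 1) ≤
        biIndepIntervalNorm M A B r ^ 2 :=
    fun r hr hr' => hlc r (by omega) (by omega)
  have hmain := lc_min_ends_ge (biIndepIntervalNorm M A B) q p hpos hlc' t hqt.le htp.le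
  have hsub : biIndepIntervalCount M A B t ≤ (indepLevelNbhd M p q t (intervalMembers M p q A B)).ncard := by
    unfold biIndepIntervalCount
    exact Set.ncard_le_ncard (biIndepInterval_subset_indepLevelNbhd M hE hqt htp hB hZ₀)
      ((levelNbhd_finite p q t _).subset (indepLevelNbhd_subset p q t _))
  unfold biIndepIntervalNorm at hmain
  rw [hE] at hmain
  have hCq : 0 < ((p + q).choose q : ℚ) := by exact_mod_cast Nat.choose_pos (by omega)
  have hCt : 0 < ((p + q).choose t : ℚ) := by exact_mod_cast Nat.choose_pos (by omega)
  have hsym : ((p + q).choose p : ℚ) = ((p + q).choose q : ℚ) := by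
    exact_mod_cast Nat.choose_symm_add (a := p) (b := q)
  rw [hsym] at hmain
  have hminC : min ((biIndepIntervalCount M A B q : ℚ) / ((p + q).choose q : ℚ))
      ((biIndepIntervalCount M A B p : ℚ) / ((p + q).choose q : ℚ)) =
      (min (biIndepIntervalCount M A B q : ℚ) (biIndepIntervalCount M A B p : ℚ)) / ((p + q).choose q : ℚ) := by
    rw [min_div_div_right hCq.le]
  rw [hminC, div_le_div_iff₀ hCq hCt] at hmain
  have hsub' : (biIndepIntervalCount M A B t : ℚ) ≤
      ((indepLevelNbhd M p q t (intervalMembers M p q A B)).ncard : ℚ) := by exact_mod_cast hsub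
  nlinarith [hmain, hsub', hCq]

end PercRepro
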